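import Summits.BirchSwinnertonDyer.BirchSwinnertonDyer.Theorems.KimAtThreeKolyvaginDeepUpperRung
import Literature.NumberTheory.EllipticCurves.SkinnerUrban2014.PAdicUnitPeriodRatioAnyPrimeProofs
import HarnessLib

/-!
# Route `KimAtThreeKolyvagin` (rung W2), crux `ShallowEqDeepAtTorsionFree`: the ONE-SIDED period comparison

Item `stmt-BirchSwinnertonDyer-19077` (`∂^{(∞)}_{deep}(δ̃) ≤ ∂^{(∞)}(δ̃)` at `t = 0`) rests, in the
cell's proof of record (HOME `kim3/KIM3-PROOF.md` §4.4 (a″)(iv), §17 Lemma K), on the SIGN of the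
normalisation exponent `e(Ω⁺_f) = v₃(c₃) + v₃(Ω_Né/Ω⁺_f)` of the optimally normalised integral
Kato system: Kato's period is the Néron real period `Ω_Né = Ω(W)` of the isogeny class (a `3`-adic
invariant of the class when `E[3]` is irreducible) and the crux needs `v₃(Ω(W)/Ω⁺_f) ≥ 0` — "Kato's
optimal period lies BELOW `Ω⁺_f`". This file proves that comparison in the kernel, at EVERY prime
`p` with `E[p]` irreducible and with NO Manin-constant datum:

* `exists_optimal_period_ratio` — for a globally minimal elliptic `W/ℚ` with `E[p]` irreducible and
  newform `f ∈ S₂(Γ₀(N))`: `Ω(W) = u · Ω⁺_f` with `u ∈ ℚ_{>0}` and `‖u‖_p = ‖c₀‖_p`, where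
  `c₀ ∈ ℤ ∖ {0}` is the Manin constant of a lattice-optimal datum (`Λ_{W₀} = c₀ Λ_f`) on a globally
  minimal model `W₀` of the strong Weil curve, `ℚ`-isogenous to `W`. Ingredients, all tree theorems:
  Edixhoven's `c₀ ∈ ℤ` in datum form (`ModularParametrizationData.exists_optimalDatum_of_edixhoven`
  with `edixhoven_int_of_neronLattice_eq_smul_periodLattice_holds`), the prime-to-`p` isogeny
  `W → W₀` (`exists_isogeny_not_dvd_degree_of_irreducible`, Greenberg–Vatsal 2000 Rem. 3.4), the
  isogeny bookkeeping on full Néron periods (`exists_int_mul_realPeriodRat_eq_of_isogeny`: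
  `q Ω(W) = a Ω(W₀)`, `q ∣ d`, `ab = d`) and `Ω(W₀) = |c₀| Ω⁺_f`
  (`realPeriodRat_eq_abs_mul_plusPeriod_of_latticeEq`). Compared with the tree's
  `exists_unit_mul_plusPeriod_of_irreducible_anyPrime` the hypothesis `p ∤ c₀` is REMOVED and the
  conclusion `‖u‖_p = 1` weakened to `‖u‖_p = ‖c₀‖_p ≤ 1`, i.e. `0 ≤ ord_p u = ord_p c₀`.
* `exists_padicValRat_nonneg_mul_plusPeriod_of_irreducible` — the short form
  `∃ u > 0, 0 ≤ ord_p u ∧ Ω(W) = u · Ω⁺_f` ("e(Ω⁺_f) − v_p(c_p) = v_p(c₀) + b ≥ 0 with b = 0": no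
  isogeny bookkeeping is lost inside a `p`-isogeny-free class).
* `natCast_le_kuriharaPartial_zero_of_le_padicValRat_of_irreducible` — the one-sided transfer it
  buys: for odd `p`, `L(E,1)/Ω(W) = q` and `m ≤ ord_p q` imply `m ≤ ∂⁽⁰⁾(δ̃) = ord_p [0]⁺_f` with NO
  period-transfer hypothesis (`[0]⁺_f = q · u`, `ord_p u ≥ 0`): every UPPER bound in
  `Ω(W)`-currency is an upper bound in `∂`-currency.
* `deepUpperAtThree_truncation_potGood_of_kato2004ManinFree_noPeriod` — consequence for the sister
  crux `DeepUpperAtThree` (item 19076): kim3's Manin-free truncation rung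
  (`KimAtThreeKolyvaginDeepUpperRung.deepUpperAtThree_truncation_potGood_of_kato2004ManinFree`)
  with its period binder `hper` DISCHARGED — `ord₃ #Ш(E/ℚ)(3) ≤ ∂⁽⁰⁾(δ̃)` on EVERY tower row with
  `3` additive potentially good, from the named Kato fact alone (hypothesis BY NAME, not asserted).
* (append) `…TamagawaExact_noPeriod` (2×), `not_three_dvd_tamagawaProduct_of_unit_of_deepLower_of_shallowEqDeep_noPeriod`
  — kim3's Tamagawa-exact reading, its consequence with the rigidity crux, and the T0-TAM kill-test
  logic, each with the period binder discharged (every tower, `t = 0`, additive pot-good row).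

Nothing here closes item 19077: the comparison is the input `e ≥ 0` of its dictionary (see the
sibling file `KimAtThreeShallowEqDeepDictionary`); the crux stays open.
[cite: GreenbergVatsal2000, §3, Remark 3.4] [cite: EdixhovenManin1991, Prop. 2 and §1]
[cite: AgasheRibetStein2006, Thm. 2.2] [cite: Kato2004Asterisque, Thm. 14.5 (3) (p. 236), Prop. 14.16 (2) (p. 244)]
[cite: Kim2022StructureSelmer, §1.4.3 and §1.5.1 (PDF p. 7)]
-/

set_option autoImplicit false
-- the Theorems namespace of a single-conjunct summit repeats the summit name by design (D-0017)
set_option linter.dupNamespace false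

noncomputable section

open scoped MatrixGroups ModularForm Classical

open CongruenceSubgroup WeierstrassCurve Literature.NumberTheory.EllipticCurves
  Literature.NumberTheory.EllipticCurves.ModularForms

namespace Summit.BirchSwinnertonDyer.BirchSwinnertonDyer.Theorems.KimAtThreeShallowEqDeepPeriod

open Summit.BirchSwinnertonDyer.Rank1Residual.Additive
open Summit.BirchSwinnertonDyer.BirchSwinnertonDyer.Theses.KimAtThreeKolyvagin
open Summit.BirchSwinnertonDyer.BirchSwinnertonDyer.Theorems.KimAtThreeKolyvaginDeepUpperRung
open Literature.NumberTheory.EllipticCurves.ModularForms.ModularParametrizationData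

/-! ### The period comparison at a `p`-isogeny-free class -/

section Period

variable (W : WeierstrassCurve ℚ) [W.IsElliptic] [W.IsGloballyMinimal] (p : ℕ) [Fact p.Prime]
  {N : ℕ} [NeZero N] (f : CuspForm (Gamma0 N) 2)

omit [W.IsGloballyMinimal] in
/-- `Ω(W) > 0` for an elliptic `W/ℚ`. [folklore] -/
private theorem realPeriodRat_pos' : 0 < W.realPeriodRat := by
  haveI : (W.baseChange ℝ).IsElliptic := by
    rw [WeierstrassCurve.baseChange]; infer_instance
  exact (W.baseChange ℝ).realPeriod_pos'

/-- For an integer `z` not divisible by `p`, `‖z‖_p = 1`. [folklore] -/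
private theorem padicNorm_intCast_eq_one_of_not_dvd {z : ℤ} (hz : ¬ (p : ℤ) ∣ z) :
    ‖((z : ℚ) : ℚ_[p])‖ = 1 := by
  rw [Rat.cast_intCast]
  exact le_antisymm (Padic.norm_int_le_one z)
    (not_lt.mp fun hlt ↦ hz (Padic.norm_intCast_lt_one_iff.mp hlt))

/-- **The optimal period ratio (Greenberg–Vatsal 2000 Rem. 3.4 with Edixhoven's integrality, NO
Manin hypothesis).** For a globally minimal elliptic `W/ℚ`, a prime `p` with `E[p]` irreducible and
the newform `f ∈ S₂(Γ₀(N))` of `W`: there are a globally minimal elliptic `W₀/ℚ`, `ℚ`-isogenous to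
`W`, a LATTICE-OPTIMAL parametrisation datum `D₀` of `W₀` at level `N` with newform `f`
(`Λ_{W₀} = c₀ · Λ_f`, `c₀ = D₀.c ∈ ℤ` its Manin constant — Edixhoven 1991 Prop. 2), and a rational
`u > 0` with `Ω(W) = u · Ω⁺_f` and `‖u‖_p = ‖c₀‖_p` (so `‖u‖_p ≤ 1`): explicitly `u = a|c₀|/q` where
`q Ω(W) = a Ω(W₀)` along an isogeny `W → W₀` of degree `d` prime to `p` (`q ∣ d`, `ab = d`, hence
`p ∤ a`, `p ∤ q`) and `Ω(W₀) = |c₀| Ω⁺_f`. [cite: GreenbergVatsal2000, §3, Remark 3.4]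
[cite: EdixhovenManin1991, Prop. 2 and §1] [cite: AgasheRibetStein2006, Thm. 2.2] -/
theorem exists_optimal_period_ratio (hirr : W.HasIrreducibleModPGaloisRep p) (hf : IsNewformOf W f) :
    ∃ (W₀ : WeierstrassCurve ℚ) (_ : W₀.IsElliptic) (_ : W₀.IsGloballyMinimal)
      (D₀ : ModularParametrizationData W₀ N) (u : ℚ),
      D₀.f = f ∧ W.IsIsogenous W₀ ∧ (∀ z ∈ D₀.L.lattice, ∃ w ∈ periodLattice D₀.f, z = D₀.c * w) ∧
        0 < u ∧ ‖(u : ℚ_[p])‖ = ‖((D₀.c : ℚ) : ℚ_[p])‖ ∧ W.realPeriodRat = u * plusPeriod f := by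
  have hpP : p.Prime := Fact.out
  -- a datum of `W` at level `N`, with newform `f`
  obtain ⟨D⟩ := Literature.NumberTheory.Automorphic.nonempty_modularParametrizationData_of_isNewformOf hf
  have hDf : D.f = f := D.isNewformOf.unique hf
  subst hDf
  -- the optimal datum on a globally minimal model of the strong Weil curve (Edixhoven: `c₀ ∈ ℤ`)
  obtain ⟨W₀, hW₀, hW₀', D₀, hf₀, hiso, hopt, -⟩ :=
    D.exists_optimalDatum_of_edixhoven
      (fun hf' hL' q hq hq' ↦ edixhoven_int_of_neronLattice_eq_smul_periodLattice_holds hf' hL' q hq hq')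
  -- an isogeny `W → W₀` of degree prime to `p`
  obtain ⟨ψ, hψ⟩ := SkinnerUrban2014.exists_isogeny_not_dvd_degree_of_irreducible (W := W) (W' := W₀)
    (Nat.cast_ne_zero.mpr hpP.ne_zero) hirr hiso
  -- the lattice step (full periods) and the optimal-curve step (exact)
  obtain ⟨q, a, b, hq0, hqd, hab, hqa⟩ := SkinnerUrban2014.exists_int_mul_realPeriodRat_eq_of_isogeny D D₀ ψ
  have hm := D₀.realPeriodRat_eq_abs_mul_plusPeriod_of_latticeEq hopt
  rw [hf₀] at hm
  have hq0' : (q : ℝ) ≠ 0 := by exact_mod_cast hq0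
  -- `p ∤ a`, `p ∤ q`
  have hpa : ¬ (p : ℤ) ∣ a := fun h ↦ hψ (Int.natCast_dvd_natCast.mp (hab ▸ h.mul_right b))
  have hpq : ¬ (p : ℤ) ∣ q := fun h ↦ hψ (Int.natCast_dvd_natCast.mp (h.trans hqd))
  -- the ratio
  set u : ℚ := ((a : ℚ) * (|D₀.c| : ℤ)) / (q : ℚ) with hu
  have hΩ : W.realPeriodRat = u * plusPeriod D.f := by
    rw [← Int.cast_abs] at hm
    have h1 : W.realPeriodRat * (q : ℝ) = ((a : ℝ) * ((|D₀.c| : ℤ) : ℝ)) * plusPeriod D.f := by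
      calc W.realPeriodRat * (q : ℝ) = (q : ℝ) * W.realPeriodRat := mul_comm _ _
        _ = a * W₀.realPeriodRat := hqa
        _ = ((a : ℝ) * ((|D₀.c| : ℤ) : ℝ)) * plusPeriod D.f := by rw [hm]; ring
    have hcast : ((u : ℚ) : ℝ) = ((a : ℝ) * ((|D₀.c| : ℤ) : ℝ)) / (q : ℝ) := by
      simp only [hu, Rat.cast_div, Rat.cast_mul, Rat.cast_intCast]
    rw [hcast, div_mul_eq_mul_div, eq_div_iff hq0']
    exact h1
  refine ⟨W₀, hW₀, hW₀', D₀, u, hf₀, hiso, hopt, ?_, ?_, hΩ⟩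
  · -- `u > 0` since `Ω(W) > 0` and `Ω⁺_f > 0`
    have hΩpos : 0 < W.realPeriodRat := realPeriodRat_pos' W
    have hplus : 0 < plusPeriod D.f :=
      IsNewform0.plusPeriod_pos_holds D.isNewformOf.1 D.isNewformOf.coeffField_eq_bot
    have : (0 : ℝ) < (u : ℝ) := by
      rw [hΩ] at hΩpos
      exact pos_of_mul_pos_left hΩpos hplus.le
    exact_mod_cast this
  · -- `‖u‖_p = ‖a‖ ‖c₀‖ / ‖q‖ = ‖c₀‖`
    have e : ((u : ℚ) : ℚ_[p]) =
        (((a : ℚ) : ℚ_[p]) * (((|D₀.c| : ℤ) : ℚ) : ℚ_[p])) / ((q : ℚ) : ℚ_[p]) := by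
      simp only [hu, Rat.cast_div, Rat.cast_mul, Rat.cast_intCast]
    have habs : ‖(((|D₀.c| : ℤ) : ℚ) : ℚ_[p])‖ = ‖((D₀.c : ℚ) : ℚ_[p])‖ := by
      rcases abs_choice D₀.c with h | h
      · rw [h]
      · rw [h]; push_cast; exact norm_neg _
    rw [e, norm_div, norm_mul, padicNorm_intCast_eq_one_of_not_dvd p hpa,
      padicNorm_intCast_eq_one_of_not_dvd p hpq, one_mul, div_one, habs]

/-- **`e(Ω⁺_f) ≥ 0` at a `p`-isogeny-free class, short form**: for a globally minimal elliptic `W/ℚ`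
with `E[p]` irreducible and newform `f`, `Ω(W) = u · Ω⁺_f` with `u ∈ ℚ`, `u > 0` and
`0 ≤ ord_p u` (`= ord_p c₀`, the Manin constant of the optimal curve: an INTEGER, Edixhoven) — i.e.
the Néron real period of the class is a `p`-INTEGRAL multiple of `Ω⁺_f` ("Kato's optimal period lies
below `Ω⁺_f`"); equality of valuations (`‖u‖_p = 1`) is the tree's
`exists_unit_mul_plusPeriod_of_irreducible_anyPrime` under the extra datum `p ∤ c₀`.
[cite: GreenbergVatsal2000, §3, Remark 3.4] [cite: EdixhovenManin1991, Prop. 2 and §1] -/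
theorem exists_padicValRat_nonneg_mul_plusPeriod_of_irreducible (hirr : W.HasIrreducibleModPGaloisRep p)
    (hf : IsNewformOf W f) :
    ∃ u : ℚ, 0 < u ∧ 0 ≤ padicValRat p u ∧ W.realPeriodRat = u * plusPeriod f := by
  obtain ⟨W₀, _, _, D₀, u, -, -, -, hu0, hnorm, hΩ⟩ := exists_optimal_period_ratio W p f hirr hf
  refine ⟨u, hu0, ?_, hΩ⟩
  have hu0' : (u : ℚ_[p]) ≠ 0 := by exact_mod_cast hu0.ne'
  have hle : ‖(u : ℚ_[p])‖ ≤ 1 := by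
    rw [hnorm, Rat.cast_intCast]
    exact Padic.norm_int_le_one _
  rw [Padic.norm_eq_zpow_neg_valuation hu0', Padic.valuation_ratCast] at hle
  have hp1 : (1 : ℝ) < (p : ℝ) := by exact_mod_cast (Fact.out : p.Prime).one_lt
  have h := (zpow_le_one_iff_right₀ hp1).mp hle
  linarith

/-- **The period ratio as a `p`-adic norm bound**: `Ω(W) = u · Ω⁺_f` with `u ≠ 0`, `‖u‖_p ≤ 1`.
[cite: GreenbergVatsal2000, §3, Remark 3.4] [cite: EdixhovenManin1991, Prop. 2 and §1] -/
theorem exists_norm_le_one_mul_plusPeriod_of_irreducible (hirr : W.HasIrreducibleModPGaloisRep p)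
    (hf : IsNewformOf W f) :
    ∃ u : ℚ, u ≠ 0 ∧ ‖(u : ℚ_[p])‖ ≤ 1 ∧ W.realPeriodRat = u * plusPeriod f := by
  obtain ⟨W₀, _, _, D₀, u, -, -, -, hu0, hnorm, hΩ⟩ := exists_optimal_period_ratio W p f hirr hf
  refine ⟨u, hu0.ne', ?_, hΩ⟩
  rw [hnorm, Rat.cast_intCast]
  exact Padic.norm_int_le_one _

end Period

/-! ### The one-sided transfer BSD currency ⇒ `∂`-currency, with no period hypothesis -/

section Bridge

variable (W : WeierstrassCurve ℚ) [W.IsElliptic] [W.IsGloballyMinimal] (p : ℕ) [Fact p.Prime]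
  {N : ℕ} [NeZero N] (f : CuspForm (Gamma0 N) 2)

/-- **BSD currency ⇒ `∂`-currency with a `p`-INTEGRAL period ratio.** For odd `p`, `E[p]`
irreducible, `f` the newform of `W` and `Ω(W) = u · Ω⁺_f` with `u ≠ 0`, `0 ≤ ord_p u`: if
`L(E,1)/Ω(W) = q` and `m ≤ ord_p q` (`m ∈ ℕ`) then `m ≤ ∂⁽⁰⁾(δ̃)` in `ℕ∞` — because
`[0]⁺_f = L(E,1)/Ω⁺_f = q · u` has `ord_p [0]⁺_f = ord_p q + ord_p u ≥ ord_p q` (and `∂⁽⁰⁾ = ⊤` if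
`[0]⁺_f = 0`). The unit case `ord_p u = 0` is
`KimAtThreeKolyvaginDeepUpperRung.natCast_le_kuriharaPartial_zero_of_le_padicValRat`.
[cite: Kim2022StructureSelmer, §1.4.3 and §1.5.1 (PDF p. 7)] [cite: MazurTateTeitelbaum1986Invent, §I.8 (8.6)] -/
theorem natCast_le_kuriharaPartial_zero_of_le_padicValRat_of_padicValRat_nonneg (hp2 : p ≠ 2)
    (hirr : W.HasIrreducibleModPGaloisRep p) (hf : IsNewformOf W f)
    {u : ℚ} (hu0 : u ≠ 0) (hu : 0 ≤ padicValRat p u) (hΩ : W.realPeriodRat = u * plusPeriod f)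
    {q : ℚ} (hq : W.entireLFunction 1 / (W.realPeriodRat : ℂ) = (q : ℂ)) {m : ℕ}
    (hm : (m : ℤ) ≤ padicValRat p q) : (m : ℕ∞) ≤ kuriharaPartial W p f 0 := by
  by_cases h0 : ratPlusSymbol f 0 = 0
  · rw [kuriharaPartial_zero_eq_top_of_ratPlusSymbol_eq_zero W p f h0]
    exact le_top
  · have hint0 : ¬ p ∣ (ratPlusSymbol f 0).den :=
      not_dvd_den_of_norm_ratCast_le_one (norm_ratPlusSymbol_le_one_of_irreducible hp2 hf hirr 0)
    have hΩf : 0 < plusPeriod f := IsNewform0.plusPeriod_pos_holds hf.1 hf.coeffField_eq_bot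
    -- `q = [0]⁺_f / u`
    have hq' : q = ratPlusSymbol f 0 / u := by
      have hu' : (u : ℂ) ≠ 0 := by exact_mod_cast hu0
      have hΩf' : ((plusPeriod f : ℝ) : ℂ) ≠ 0 := by exact_mod_cast hΩf.ne'
      have h1 : (q : ℂ) = ((ratPlusSymbol f 0 / u : ℚ) : ℂ) := by
        rw [← hq, hf.entireLFunction_one_eq, hΩ]
        push_cast
        field_simp
      exact_mod_cast h1
    have hq0 : q ≠ 0 := by
      rw [hq']
      exact div_ne_zero h0 hu0
    -- `ord_p q = ord_p [0]⁺_f - ord_p u ≤ ord_p [0]⁺_f`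
    have hval : padicValRat p q = padicValRat p (ratPlusSymbol f 0) - padicValRat p u := by
      rw [hq', padicValRat.div h0 hu0]
    have hm' : (m : ℤ) ≤ padicValRat p (ratPlusSymbol f 0) := by
      rw [hval] at hm
      linarith
    rw [kuriharaPartial_zero, kuriharaDivIndex_one_eq W p f hint0 h0]
    have hnat : m ≤ (padicValRat p (ratPlusSymbol f 0)).toNat := by omega
    exact_mod_cast hnat

/-- **BSD currency ⇒ `∂`-currency with NO period hypothesis** (odd `p`, `E[p]` irreducible, `W`
globally minimal, `f` its newform): `L(E,1)/Ω(W) = q` and `m ≤ ord_p q` imply `m ≤ ∂⁽⁰⁾(δ̃)` — the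
period ratio `Ω(W)/Ω⁺_f` is `p`-integral by `exists_padicValRat_nonneg_mul_plusPeriod_of_irreducible`.
Every UPPER bound proved in print in the Néron-period currency (Kato 2004 Thm. 14.5, Kim–Nakamura
2020, …) is therefore an upper bound on the same quantity in the `∂`-currency of the route's cruxes,
on the whole `p`-isogeny-free locus, with no Manin / period-transfer datum.
[cite: GreenbergVatsal2000, §3, Remark 3.4] [cite: Kim2022StructureSelmer, §1.5.1 (PDF p. 7)] -/
theorem natCast_le_kuriharaPartial_zero_of_le_padicValRat_of_irreducible (hp2 : p ≠ 2)
    (hirr : W.HasIrreducibleModPGaloisRep p) (hf : IsNewformOf W f)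
    {q : ℚ} (hq : W.entireLFunction 1 / (W.realPeriodRat : ℂ) = (q : ℂ)) {m : ℕ}
    (hm : (m : ℤ) ≤ padicValRat p q) : (m : ℕ∞) ≤ kuriharaPartial W p f 0 := by
  obtain ⟨u, hu0, hu, hΩ⟩ := exists_padicValRat_nonneg_mul_plusPeriod_of_irreducible W p f hirr hf
  exact natCast_le_kuriharaPartial_zero_of_le_padicValRat_of_padicValRat_nonneg W p f hp2 hirr hf
    hu0.ne' hu hΩ hq hm

end Bridge

/-! ### Consequence for the sister crux `DeepUpperAtThree`: the Manin-free truncation rung needs no period datum -/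

/-- Under the tower (use `n = 1`), `E[3]` is irreducible. [folklore] -/
private theorem irreducible_three_of_tower (W : WeierstrassCurve ℚ) [W.IsElliptic]
    (htower : ∀ n : ℕ, W.HasSurjectiveModNGaloisRep (3 ^ n : ℕ)) :
    W.HasIrreducibleModPGaloisRep 3 :=
  hasIrreducibleModPGaloisRep_of_hasSurjectiveModNGaloisRep W 3 (by simpa using htower 1)

/-- **kim3's Manin-free truncation rung of `DeepUpperAtThree` with the period binder DISCHARGED.**
From the named fact `hKato` (Kato 2004 Thm. 14.5 (3) + Prop. 14.16 (2), Manin-free `c₃`-sharpened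
reading: `ord₃ #Ш(E/ℚ)(3) ≤ ord₃(L(E,1)/Ω(W)) − v₃(c₃)` at an additive potentially good `3` under
Kato's (12.5.2)): for `W/ℚ` globally minimal with `ρ_{E,3^n}` onto for all `n`, `Ш(E/ℚ)` finite, `f`
the newform (the crux's integrality and `ord(δ̃) = 0` binders carried verbatim, unused), `3` ADDITIVE
and POTENTIALLY GOOD: `ord₃ #Ш(E/ℚ)(3) ≤ ∂⁽⁰⁾(δ̃)`. Compared with
`KimAtThreeKolyvaginDeepUpperRung.deepUpperAtThree_truncation_potGood_of_kato2004ManinFree` the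
hypothesis `hper : ∃ u, ‖u‖₃ = 1 ∧ Ω(W) = u·Ω⁺_f` (the cell's C10-R datum) is GONE: the one-sided
comparison `0 ≤ ord₃(Ω(W)/Ω⁺_f)` suffices for an upper bound and is a theorem under the tower.
A rung of item `stmt-BirchSwinnertonDyer-19076`; nothing asserted.
[cite: Kato2004Asterisque, Thm. 14.5 (3) (p. 236), Prop. 14.16 (2) (p. 244), Prop. 14.21 and 14.22 (pp. 248–249)]
[cite: GreenbergVatsal2000, §3, Remark 3.4] [cite: Kim2022StructureSelmer, §1.5.1 (PDF p. 7)] -/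
theorem deepUpperAtThree_truncation_potGood_of_kato2004ManinFree_noPeriod
    (hKato : Kato2004.rankZero_padicValNat_sha_le_sub_localTamagawa_of_additive_potGood_of_imageContainsSL2_maninFree) :
    ∀ (W : WeierstrassCurve ℚ) [W.IsElliptic] [W.IsGloballyMinimal],
      (∀ n : ℕ, W.HasSurjectiveModNGaloisRep (3 ^ n : ℕ)) →
      Finite W.sha →
      ∀ {N : ℕ} [NeZero N] (f : CuspForm (Gamma0 N) 2), IsNewformOf W f →
      (∀ r : ℚ, ratPlusSymbol f r ≠ 0 → 0 ≤ padicValRat 3 (ratPlusSymbol f r)) →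
      kuriharaVanishingOrder W 3 f = 0 →
      ¬ W.HasGoodReductionAtPrime 3 → ¬ W.HasMultiplicativeReductionAtPrime 3 →
      0 ≤ padicValRat 3 W.j →
        ((padicValNat 3 (Nat.card (AddCommGroup.primaryComponent W.sha 3)) : ℕ) : ℕ∞) ≤
          kuriharaPartial W 3 f 0 := by
  intro W _ _ htower hfin N _ f hf _ _ hgood hmult hpot
  haveI : Fact (Nat.Prime 3) := ⟨Nat.prime_three⟩
  by_cases h0 : ratPlusSymbol f 0 = 0
  · rw [kuriharaPartial_zero_eq_top_of_ratPlusSymbol_eq_zero W 3 f h0]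
    exact le_top
  · obtain ⟨q, hq, hle⟩ := hKato W 3 (by norm_num) hgood hmult hpot
      (Kato2004.imageContainsSL2_of_forall_hasSurjectiveModNGaloisRep W 3 htower)
      (hf.entireLFunction_one_ne_zero_of_ratPlusSymbol_zero_ne_zero h0) hfin
    have hle' : (padicValNat 3 (Nat.card (AddCommGroup.primaryComponent W.sha 3)) : ℤ) ≤
        padicValRat 3 q := by
      have h0' : (0 : ℤ) ≤ padicValNat 3 ((W.baseChange ℚ_[3]).localTamagawaNumber ℤ_[3]) := by
        positivity
      linarith
    exact natCast_le_kuriharaPartial_zero_of_le_padicValRat_of_irreducible W 3 f (by norm_num)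
      (irreducible_three_of_tower W htower) hf hq hle'


/-! ### The Tamagawa-exact reading and the T0-TAM kill-test logic with no period datum (append, 2026-08-26) -/

/-- **`ord₃ #Ш(E/ℚ)(3) + v₃(∏ c_ℓ) ≤ ∂⁽⁰⁾(δ̃)` on Kato's stratum with NO period datum** (kim3's
`sha_add_tamagawa_le_kuriharaPartial_zero_of_kato2004TamagawaExact`, the Tamagawa-EXACT reading `hKato`
by name, with `hper` discharged): tower onto, `Ш` finite, `f` the newform, `3` additive pot-good.
[cite: Kato2004Asterisque, Thm. 14.5 (3) (p. 236), Prop. 14.16 (2) (p. 244), §14.8 (p. 238)]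
[cite: GreenbergVatsal2000, §3, Remark 3.4] [cite: Kim2022StructureSelmer, §1.5.1 (PDF p. 7)] -/
theorem sha_add_tamagawa_le_kuriharaPartial_zero_of_kato2004TamagawaExact_noPeriod
    (hKato : Kato2004.rankZero_padicValNat_sha_add_padicValNat_tamagawa_le_of_additive_potGood_of_imageContainsSL2) :
    ∀ (W : WeierstrassCurve ℚ) [W.IsElliptic] [W.IsGloballyMinimal],
      (∀ n : ℕ, W.HasSurjectiveModNGaloisRep (3 ^ n : ℕ)) →
      Finite W.sha →
      ∀ {N : ℕ} [NeZero N] (f : CuspForm (Gamma0 N) 2), IsNewformOf W f →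
      kuriharaVanishingOrder W 3 f = 0 →
      ¬ W.HasGoodReductionAtPrime 3 → ¬ W.HasMultiplicativeReductionAtPrime 3 →
      0 ≤ padicValRat 3 W.j →
        ((padicValNat 3 (Nat.card (AddCommGroup.primaryComponent W.sha 3)) +
            padicValNat 3 W.tamagawaProduct : ℕ) : ℕ∞) ≤ kuriharaPartial W 3 f 0 := by
  intro W _ _ htower hfin N _ f hf _ hgood hmult hpot
  haveI : Fact (Nat.Prime 3) := ⟨Nat.prime_three⟩
  by_cases h0 : ratPlusSymbol f 0 = 0
  · rw [kuriharaPartial_zero_eq_top_of_ratPlusSymbol_eq_zero W 3 f h0]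
    exact le_top
  · obtain ⟨q, hq, hle⟩ := hKato W 3 (by norm_num) hgood hmult hpot
      (Kato2004.imageContainsSL2_of_forall_hasSurjectiveModNGaloisRep W 3 htower)
      (hf.entireLFunction_one_ne_zero_of_ratPlusSymbol_zero_ne_zero h0) hfin
    exact natCast_le_kuriharaPartial_zero_of_le_padicValRat_of_irreducible W 3 f (by norm_num)
      (irreducible_three_of_tower W htower) hf hq (by rw [Nat.cast_add]; exact hle)

/-- **Rigidity crux + Tamagawa-exact Kato ⟹ `v₃(∏ c_ℓ) ≤ ∂^{(∞)}_{deep}(δ̃)` with NO period datum**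
(kim3's version minus `hper`; CONDITIONAL on `DeepLowerAtThree` by name and the named fact).
[cite: Kim2022StructureSelmer, Conj. 1.10 (PDF p. 8)]
[cite: Kato2004Asterisque, Thm. 14.5 (3) (p. 236), Prop. 14.16 (2) (p. 244), §14.8 (p. 238)] -/
theorem tamagawa_le_kuriharaPartialDeepInfty_of_deepLowerAtThree_of_kato2004TamagawaExact_noPeriod
    (hL : DeepLowerAtThree)
    (hKato : Kato2004.rankZero_padicValNat_sha_add_padicValNat_tamagawa_le_of_additive_potGood_of_imageContainsSL2) :
    ∀ (W : WeierstrassCurve ℚ) [W.IsElliptic] [W.IsGloballyMinimal],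
      (∀ n : ℕ, W.HasSurjectiveModNGaloisRep (3 ^ n : ℕ)) →
      Finite W.sha →
      ∀ {N : ℕ} [NeZero N] (f : CuspForm (Gamma0 N) 2), IsNewformOf W f →
      (∀ r : ℚ, ratPlusSymbol f r ≠ 0 → 0 ≤ padicValRat 3 (ratPlusSymbol f r)) →
      kuriharaVanishingOrder W 3 f = 0 →
      ¬ W.HasGoodReductionAtPrime 3 → ¬ W.HasMultiplicativeReductionAtPrime 3 →
      0 ≤ padicValRat 3 W.j →
        ((padicValNat 3 W.tamagawaProduct : ℕ) : ℕ∞) ≤ kuriharaPartialDeepInfty W 3 f := by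
  intro W _ _ htower hfin N _ f hf hint hord hgood hmult hpot
  obtain ⟨d, hd, hle⟩ := hL W htower hfin f hf hint hord
  have hge := sha_add_tamagawa_le_kuriharaPartial_zero_of_kato2004TamagawaExact_noPeriod hKato W htower
    hfin f hf hord hgood hmult hpot
  have h : ((padicValNat 3 (Nat.card (AddCommGroup.primaryComponent W.sha 3)) +
      padicValNat 3 W.tamagawaProduct : ℕ) : ℕ∞) ≤
      ((padicValNat 3 (Nat.card (AddCommGroup.primaryComponent W.sha 3)) + d : ℕ) : ℕ∞) :=
    hge.trans hle
  have h' : padicValNat 3 (Nat.card (AddCommGroup.primaryComponent W.sha 3)) +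
      padicValNat 3 W.tamagawaProduct ≤
      padicValNat 3 (Nat.card (AddCommGroup.primaryComponent W.sha 3)) + d := by
    exact_mod_cast h
  rw [hd]
  exact_mod_cast Nat.le_of_add_le_add_left h'

/-- **The T0-TAM kill-test logic with NO period datum** (kim3's `not_three_dvd_tamagawaProduct_of_unit_…`
minus `hper`): (`DeepLowerAtThree` ∧ `ShallowEqDeepAtTorsionFree`) + Kato's Tamagawa-EXACT reading ⟹ on
EVERY tower, `t = 0`, additive pot-good row (optimal or not) a UNIT Kurihara number at ANY cyclic level
forces `3 ∤ ∏_ℓ c_ℓ`; one unit on such a row with `3 ∣ ∏ c_ℓ` refutes the conjunction given print.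
[cite: Kato2004Asterisque, Thm. 14.5 (3) (p. 236), Prop. 14.16 (2) (p. 244), §14.8 (p. 238)]
[cite: Kim2025RefinedTNC, Thm 1.1] [cite: Kim2022StructureSelmer, §1.5.1 (PDF p. 7), Conj. 1.10 (PDF p. 8)] -/
theorem not_three_dvd_tamagawaProduct_of_unit_of_deepLower_of_shallowEqDeep_noPeriod
    (hL : DeepLowerAtThree) (hS : ShallowEqDeepAtTorsionFree)
    (hKato : Kato2004.rankZero_padicValNat_sha_add_padicValNat_tamagawa_le_of_additive_potGood_of_imageContainsSL2)
    (W : WeierstrassCurve ℚ) [W.IsElliptic] [W.IsGloballyMinimal]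
    (htower : ∀ n : ℕ, W.HasSurjectiveModNGaloisRep (3 ^ n : ℕ))
    (ht0 : Nat.card {Q : (W.baseChange ℚ_[3]).toAffine.Point // (3 : ℕ) • Q = 0} = 1)
    (hfin : Finite W.sha) {N : ℕ} [NeZero N] (f : CuspForm (Gamma0 N) 2) (hf : IsNewformOf W f)
    (hint : ∀ r : ℚ, ratPlusSymbol f r ≠ 0 → 0 ≤ padicValRat 3 (ratPlusSymbol f r))
    (hord : kuriharaVanishingOrder W 3 f = 0)
    (hgood : ¬ W.HasGoodReductionAtPrime 3) (hmult : ¬ W.HasMultiplicativeReductionAtPrime 3)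
    (hpot : 0 ≤ padicValRat 3 W.j)
    {n : ℕ} [NeZero n] (hn : IsCyclicKolyvaginLevel W 3 n)
    (ψ : (ℓ : ℕ) → (ZMod ℓ)ˣ →* Multiplicative (ZMod (3 ^ 1)))
    (hψ : ∀ ℓ ∈ n.primeFactors, Function.Surjective (ψ ℓ))
    (hunit : kuriharaNumber f (3 ^ 1) n ψ ≠ 0) : ¬ 3 ∣ W.tamagawaProduct := by
  haveI : Fact (Nat.Prime 3) := ⟨Nat.prime_three⟩
  intro hdvd
  have h1 := tamagawa_le_kuriharaPartialDeepInfty_of_deepLowerAtThree_of_kato2004TamagawaExact_noPeriod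
    hL hKato W htower hfin f hf hint hord hgood hmult hpot
  have h2 : kuriharaPartialDeepInfty W 3 f ≤ kuriharaPartialInfty W 3 f :=
    hS W htower ht0 hfin f hf hint hord
  have h3 : kuriharaPartialInfty W 3 f = 0 := kuriharaPartialInfty_eq_zero_of_ne_zero W 3 f hn ψ hψ hunit
  have h : ((padicValNat 3 W.tamagawaProduct : ℕ) : ℕ∞) ≤ 0 := (h1.trans h2).trans h3.le
  have h' : padicValNat 3 W.tamagawaProduct = 0 := by exact_mod_cast nonpos_iff_eq_zero.mp h
  have h1' : 1 ≤ padicValNat 3 W.tamagawaProduct :=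
    one_le_padicValNat_of_dvd W.tamagawaProduct_pos'.ne' hdvd
  omega

end Summit.BirchSwinnertonDyer.BirchSwinnertonDyer.Theorems.KimAtThreeShallowEqDeepPeriod

end
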